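import Summits.BirchSwinnertonDyer.BirchSwinnertonDyer.Theorems.ByReductionTypeAtTwoSupersingularConjATwoGoodSSDoor
import Summits.BirchSwinnertonDyer.BirchSwinnertonDyer.Theorems.ByReductionTypeAtTwoFineSelmerConjAAtTwoAdditivePotGoodMinkowskiDoor
import Summits.BirchSwinnertonDyer.BirchSwinnertonDyer.Theorems.ByReductionTypeAtTwoFineSelmerConjAAtTwoAdditivePotGoodClassNumberOne780
import Summits.BirchSwinnertonDyer.BirchSwinnertonDyer.Theorems.ByReductionTypeAtTwoSupersingularUnitAnchorsA
import Summits.BirchSwinnertonDyer.BirchSwinnertonDyer.Theorems.ByReductionTypeAtTwoSupersingularUnitAnchorsC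
import Summits.BirchSwinnertonDyer.BirchSwinnertonDyer.Theorems.ByReductionTypeAtTwoSupersingularUnitAnchorsD
import HarnessLib

/-!
# Route `ByReductionTypeAtTwo` (rung K4), crux `SupersingularRankZeroAtTwo` (item stmt-BirchSwinnertonDyer-19097), v2.12 (α) `FineMuZeroOnHabitatAtTwo`:
# GOOD-SUPERSINGULAR ROW STAMPS, part A — `Rank1Residual.FineMuZeroAt (M ⊗ ℚ) 2` / Coates–Sujatha (A)₂ for habitat rows `11a1` … `77b1` (rows 1–10 of the habitat by conductor) by conductor
# (Cremona minimal models `M`), each modulo print `hLim2` and — unless the kernel decides it — ONE displayed parity bit «`2 ∤ h(L_W)`»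
# (a `--supports 19097` file; seat `bsd-2adic-t42` GEN 43, hand h12 «D84 ROW-CERTIFICATE TYPING», director (810)(B) HAND 1; door `…GoodSSDoor`)

HONEST LABEL (cell `bsd-2adic`, D-0036/D-0054): «row certificates mod print (Lim 2017 Thm 3.5); (α) is class-wide and NOT discharged; CDC_H closed
MOD PRINT hPT; BSD proved for no curve». Per-row stamps only: they are BC5-type witnesses / honesty data for the registry's (α) binder
`∀ W [IsElliptic] [IsGloballyMinimal], ¬CM → r_an = 0 → GoodSS W 2 → Rank1Residual.FineMuZeroAt W 2` and do not discharge its `∀`; nothing booked.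
`IsGloballyMinimal` / `GoodSS` / `r_an = 0` / non-CM of the rows are NOT claimed here; for the rows that are UNIT ANCHORS of seat ss-1x (`…SupersingularUnitAnchorsA/C/D`)
the tree's `SSUnitAnchor.isElliptic_ua…` instance is REUSED (dedup) and `isGloballyMinimal_ua…` / `goodSS_two_ua…` decide the first two on the same `M ⊗ ℚ`.

THE HABITAT (crux 19097): non-CM, `r_an = 0`, good SUPERSINGULAR at `2` (`N` odd, `a₂(E) ∈ {0, ±2}`). Census of this hand (kit j343820, one batched PARI job
over Cremona `allcurves.00000-09999`): the 104 habitat isogeny classes with `N ≤ 600` (curve `1` of each class) all have `a₁ = 0, a₃ = 1`; their `2`-division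
cubic fields `L_W = ℚ(x(P))` (`2 = 𝔮³` always, Eisenstein) have ODD class number in 103/104 cases (`h ∈ {1, 3}`; the exception `571a1`: `d = −2284`, `h = 2`,
a layer-≥ 1 row of census2 j305417 — recorded in the cell memo `t42/D84-ROWS-GEN43.md`, not stamped). MECHANISM: `…GoodSSDoor` (the `2`-torsion point
`(β/4, −1/2)`, `β = 4x(P)` a root of `X³ + 4a₂X² + 16a₄X + (64a₆ + 16)`; `π = β/2` root of the Eisenstein cubic `Y³ + 2a₂Y² + 4a₄Y + (8a₆ + 2)`).

THIS PART (A): 10 rows — KERNEL bit (modulo `hLim2` ALONE, generator swap to a class-number-one field decided by the kernel: `d ∈ {−44, −76, −108, −780}`): `11a1`, `19a1`, `57c1`, `77b1`; DISPLAYED bit (`2 ∤ #Cl(𝓞 ℚ(β))`, census value in the docstring): `35a1`, `37b1`, `51a1`, `67a1`, `75a1`, `75c1`. §0 carries the four kernel class-number lemmas used by all parts.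

References: [Lim2017FineSelmer] Thm. 3.5, Lemma 3.2; [CoatesSujatha2005] (A); [Greenberg2001IwasawaPastPresent] Prop. 2.1 p. 339; [Cohen1993] App. B
Table B.4; [Marcus1977] Ch. 5; [CremonaAlgorithms1997] Table 1 (`allcurves`/`allbsd`); kit j343820 (`t42/gen43/h12rows.gp`, PARI 2.15: polredabs, bnfinit, bnfcertify).
-/

set_option autoImplicit false
-- sibling precedent (`…GoodSSDoor.lean`): the directory name repeats the summit name
set_option linter.dupNamespace false

noncomputable section

open scoped Classical IntermediateField NumberField

namespace Summit.BirchSwinnertonDyer.BirchSwinnertonDyer.Theorems.AddKatoTwo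

open WeierstrassCurve Field Polynomial IsDedekindDomain Literature.NumberTheory.EllipticCurves
  Literature.NumberTheory.GaloisRepresentations Literature.NumberTheory.IwasawaTheory
  Summit.BirchSwinnertonDyer.BirchSwinnertonDyer.Theorems.AlignedTransportAtTwoTorsionPointField
  Summit.BirchSwinnertonDyer.BirchSwinnertonDyer.Theses.ByReductionTypeAtTwo

/-! ## §0 The four `2`-division cubic fields of the tranche whose class number is ONE by the KERNEL -/

/-- `2 ∤ #Cl(𝓞 ℚ(θ))` for every root `θ` of `X³ − X² + X + 1` (`d = −44`; no root mod `3`, `|disc| = 44 ≤ 45`: `h = 1` by Minkowski, kernel).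
[cite: Cohen1993, App. B Table B.4 (d = −44)] -/
theorem not_two_dvd_card_classGroup_twoDivField_d44n {θ : AlgebraicClosure ℚ}
    (hθ : aeval θ (Cubic.toPoly ⟨1, ((-1 : ℤ) : ℚ), ((1 : ℤ) : ℚ), ((1 : ℤ) : ℚ)⟩) = 0) :
    ¬ 2 ∣ Nat.card (ClassGroup (𝓞 (IntermediateField.adjoin ℚ {θ}))) :=
  haveI : Fact (Nat.Prime 3) := ⟨by norm_num⟩
  not_two_dvd_card_classGroup_adjoin_of_abs_discr_le (irreducible_cubic_of_no_root_zmod 3 (by decide))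
    (by simp only [Cubic.discr]; norm_num) hθ

/-- `2 ∤ #Cl(𝓞 ℚ(θ))` for every root `θ` of `X³ − 2X − 2` (`d = −76`; Eisenstein with `r = −2`, `|disc| = 76 ≤ 108`: `h = 1`, kernel).
[cite: Cohen1993, App. B Table B.4 (d = −76)] -/
theorem not_two_dvd_card_classGroup_twoDivField_d76n {θ : AlgebraicClosure ℚ}
    (hθ : aeval θ (Cubic.toPoly ⟨1, ((0 : ℤ) : ℚ), ((-2 : ℤ) : ℚ), ((-2 : ℤ) : ℚ)⟩) = 0) :
    ¬ 2 ∣ Nat.card (ClassGroup (𝓞 (IntermediateField.adjoin ℚ {θ}))) := by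
  rw [card_classGroup_adjoin_eq_one_of_eisenstein_two_of_abs_discr_le (p := 0) (q := -2) (r := -2) (by decide) (by decide)
    (Or.inr rfl) (by simp only [Cubic.discr]; norm_num) hθ]
  norm_num

/-- `2 ∤ #Cl(𝓞 ℚ(θ))` for every root `θ` of `X³ − 2` (`ℚ(∛2)`, `d = −108`; Eisenstein with `r = −2`, `|disc| = 108`: `h = 1`, kernel).
[cite: Cohen1993, App. B Table B.4 (d = −108)] -/
theorem not_two_dvd_card_classGroup_twoDivField_d108n {θ : AlgebraicClosure ℚ}
    (hθ : aeval θ (Cubic.toPoly ⟨1, ((0 : ℤ) : ℚ), ((0 : ℤ) : ℚ), ((-2 : ℤ) : ℚ)⟩) = 0) :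
    ¬ 2 ∣ Nat.card (ClassGroup (𝓞 (IntermediateField.adjoin ℚ {θ}))) := by
  rw [card_classGroup_adjoin_eq_one_of_eisenstein_two_of_abs_discr_le (p := 0) (q := 0) (r := -2) (by decide) (by decide)
    (Or.inr rfl) (by simp only [Cubic.discr]; norm_num) hθ]
  norm_num

/-- `2 ∤ #Cl(𝓞 ℚ(θ))` for every root `θ` of `X³ − X² − X − 5` (`d = −780`; the tree's norm certificate `…ClassNumberOne780`, kernel).
[cite: Marcus1977, Ch. 5 Thm. 37 and Cor. 2] -/
theorem not_two_dvd_card_classGroup_twoDivField_d780n {θ : AlgebraicClosure ℚ}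
    (hθ : aeval θ (Cubic.toPoly ⟨1, ((-1 : ℤ) : ℚ), ((-1 : ℤ) : ℚ), ((-5 : ℤ) : ℚ)⟩) = 0) :
    ¬ 2 ∣ Nat.card (ClassGroup (𝓞 (IntermediateField.adjoin ℚ {θ}))) := by
  rw [card_classGroup_adjoin_eq_one_disc_neg780 hθ]
  norm_num

/-! ## Rows 1–10 -/

/-! ### Row `11a1` = `[0, -1, 1, -10, -20]` (`a₂(E) = −2`; `L_W`: `x³ − x² + x + 1`, `d = −44`, `h = 1`) -/

-- `IsElliptic` for `11a1 ⊗ ℚ`: inlined (`isElliptic_goodSSModel`; an equal statement exists in `TwinAlgMuZeroAtThree/Negative/GuardCuts`).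

/-- **(A)₂ for `11a1` modulo Lim 2017 Thm. 3.5 (`hLim2`) ALONE — NO displayed datum.** Generator swap: `θ = (-23/121) + (-31/242)·β + (3/484)·β²` is a root of `g = X³ − X² + X + 1` (`d = −44`) and `β = (8) + (-14)·θ + (6)·θ²`, so `ℚ(P) = ℚ(β) = ℚ(θ)`; `2 ∤ #Cl(𝓞 ℚ(θ))` BY THE KERNEL (|disc g| = 44 ≤ 45, `…CubicDiscriminant.not_two_dvd_card_classGroup_adjoin_of_abs_discr_le`). Row data (Cremona `allcurves`/`allbsd`): minimal model `[0,-1,1,-10,-20]`, `N = 11`, `a₂(E) = −2` (good supersingular at `2`), `r = 0`, `#tors = 5`, non-CM; `2`-division cubic of `β = 4x(P)`: `X³ − 4X² − 160X − 1264`; Eisenstein cubic of `π = 2x(P)`: `Y³ − 2Y² − 40Y − 158`; `L_W = ℚ(β) ≅ ℚ[x]/(x³ − x² + x + 1)`, complex cubic (Δ_E < 0), `d(L_W) = −44`, `h(L_W) = 1` (kit j343820: polredabs/bnfinit, `bnfcertify = 1`). [cite: Lim2017FineSelmer, §3 Thm. 3.5 and Lemma 3.2] [cite: CoatesSujatha2005,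 §3 statement (A)] -/
theorem conjA_two_11a1
    (hLim2 : Lim2017.thm35_at_two_fineSelmerDual_moduleFinite_of_classicalMuVanishes_of_le_divisionField_four)
    (κ : ZpExtension ℚ 2) (hκ : κ.IsCyclotomic) :
    haveI := isElliptic_goodSSModel (-1) (-10) (-20) (by simp only [Cubic.discr]; norm_num)
    ∃ (γ : absoluteGaloisGroup ℚ) (D : ((⟨0, -1, 1, -10, -20⟩ : WeierstrassCurve ℤ).baseChange ℚ).FineSelmerDualData κ γ),
      Module.Finite ℤ_[2] (RestrictScalars ℤ_[2] (IwasawaAlgebra 2) D.X) := by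
  haveI := isElliptic_goodSSModel (-1) (-10) (-20) (by simp only [Cubic.discr]; norm_num)
  refine conjA_two_goodSSModel_of_generator hLim2 (-1) (-10) (-20) (-1) (1) (1) (-23/121) (-31/242) (3/484) (8) (-14) (6)
    (fun β θ hβ hθ ↦ ?_) (fun θ hθ ↦ not_two_dvd_card_classGroup_twoDivField_d44n hθ) κ hκ
  subst hθ; push_cast at hβ ⊢
  exact ⟨by linear_combination (((-8599 : AlgebraicClosure ℚ) / 14172488) + ((6453 : AlgebraicClosure ℚ) / 28344976) * β + ((-783 : AlgebraicClosure ℚ) / 56689952) * β ^ 2 + ((27 : AlgebraicClosure ℚ) / 113379904) * β ^ 3) * hβ,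
    by linear_combination (-1 : AlgebraicClosure ℚ) * (((-126 : AlgebraicClosure ℚ) / 14641) + ((27 : AlgebraicClosure ℚ) / 117128) * β) * hβ⟩

/-- **`FineMuZeroAt (11a1 ⊗ ℚ) 2` modulo `hLim2` ALONE** (kernel bit via the `d = −44` generator swap). [cite: Lim2017FineSelmer, §3 Thm. 3.5 and Lemma 3.2] [cite: CoatesSujatha2005, §3 statement (A)] -/
theorem fineMuZeroAt_two_11a1
    (hLim2 : Lim2017.thm35_at_two_fineSelmerDual_moduleFinite_of_classicalMuVanishes_of_le_divisionField_four) :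
    haveI := isElliptic_goodSSModel (-1) (-10) (-20) (by simp only [Cubic.discr]; norm_num)
    Literature.NumberTheory.EllipticCurves.Rank1Residual.FineMuZeroAt ((⟨0, -1, 1, -10, -20⟩ : WeierstrassCurve ℤ).baseChange ℚ) 2 :=
  haveI := isElliptic_goodSSModel (-1) (-10) (-20) (by simp only [Cubic.discr]; norm_num)
  Literature.NumberTheory.EllipticCurves.Rank1Residual.ConjAAt.fineMuZeroAt (conjA_two_11a1 hLim2)

/-! ### Row `19a1` = `[0, 1, 1, -9, -15]` (`a₂(E) = 0`; `L_W`: `x³ − 2x − 2`, `d = −76`, `h = 1`) -/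

-- `IsElliptic` for `19a1 ⊗ ℚ` is the tree's `SSUnitAnchor.isElliptic_ua19a1` (reused, not restated).

/-- **(A)₂ for `19a1` modulo Lim 2017 Thm. 3.5 (`hLim2`) ALONE — NO displayed datum.** Generator swap: `θ = (30/19) + (7/38)·β + (-1/76)·β²` is a root of `g = X³ − 2X − 2` (`d = −76`) and `β = (-4) + (6)·θ + (2)·θ²`, so `ℚ(P) = ℚ(β) = ℚ(θ)`; `2 ∤ #Cl(𝓞 ℚ(θ))` BY THE KERNEL (Eisenstein, r = −2, |disc g| = 76 ≤ 108, `…MinkowskiDoor.card_classGroup_adjoin_eq_one_of_eisenstein_two_of_abs_discr_le`). Row data (Cremona `allcurves`/`allbsd`): minimal model `[0,1,1,-9,-15]`, `N = 19`, `a₂(E) = 0` (good supersingular at `2`), `r = 0`, `#tors = 3`, non-CM; `2`-division cubic of `β = 4x(P)`: `X³ + 4X² − 144X − 944`; Eisenstein cubic of `π = 2x(P)`: `Y³ + 2Y² − 36Y − 118`; `L_W = ℚ(β) ≅ ℚ[x]/(x³ − 2x − 2)`, complex cubic (Δ_E < 0), `d(L_W) = −76`, `h(L_W) = 1` (kit j343820: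 polredabs/bnfinit, `bnfcertify = 1`). [cite: Lim2017FineSelmer, §3 Thm. 3.5 and Lemma 3.2] [cite: CoatesSujatha2005, §3 statement (A)] -/
theorem conjA_two_19a1
    (hLim2 : Lim2017.thm35_at_two_fineSelmerDual_moduleFinite_of_classicalMuVanishes_of_le_divisionField_four)
    (κ : ZpExtension ℚ 2) (hκ : κ.IsCyclotomic) :
    haveI := SSUnitAnchor.isElliptic_ua19a1
    ∃ (γ : absoluteGaloisGroup ℚ) (D : ((⟨0, 1, 1, -9, -15⟩ : WeierstrassCurve ℤ).baseChange ℚ).FineSelmerDualData κ γ),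
      Module.Finite ℤ_[2] (RestrictScalars ℤ_[2] (IwasawaAlgebra 2) D.X) := by
  haveI := SSUnitAnchor.isElliptic_ua19a1
  refine conjA_two_goodSSModel_of_generator hLim2 (1) (-9) (-15) (0) (-2) (-2) (30/19) (7/38) (-1/76) (-4) (6) (2)
    (fun β θ hβ hθ ↦ ?_) (fun θ hθ ↦ not_two_dvd_card_classGroup_twoDivField_d76n hθ) κ hκ
  subst hθ; push_cast at hβ ⊢
  exact ⟨by linear_combination (((71 : AlgebraicClosure ℚ) / 54872) + ((-139 : AlgebraicClosure ℚ) / 109744) * β + ((23 : AlgebraicClosure ℚ) / 219488) * β ^ 2 + ((-1 : AlgebraicClosure ℚ) / 438976) * β ^ 3) * hβ,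
    by linear_combination (-1 : AlgebraicClosure ℚ) * (((-4 : AlgebraicClosure ℚ) / 361) + ((1 : AlgebraicClosure ℚ) / 2888) * β) * hβ⟩

/-- **`FineMuZeroAt (19a1 ⊗ ℚ) 2` modulo `hLim2` ALONE** (kernel bit via the `d = −76` generator swap). [cite: Lim2017FineSelmer, §3 Thm. 3.5 and Lemma 3.2] [cite: CoatesSujatha2005, §3 statement (A)] -/
theorem fineMuZeroAt_two_19a1
    (hLim2 : Lim2017.thm35_at_two_fineSelmerDual_moduleFinite_of_classicalMuVanishes_of_le_divisionField_four) :
    haveI := SSUnitAnchor.isElliptic_ua19a1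
    Literature.NumberTheory.EllipticCurves.Rank1Residual.FineMuZeroAt ((⟨0, 1, 1, -9, -15⟩ : WeierstrassCurve ℤ).baseChange ℚ) 2 :=
  haveI := SSUnitAnchor.isElliptic_ua19a1
  Literature.NumberTheory.EllipticCurves.Rank1Residual.ConjAAt.fineMuZeroAt (conjA_two_19a1 hLim2)

/-! ### Row `35a1` = `[0, 1, 1, 9, 1]` (`a₂(E) = 0`; `L_W`: `x³ + 2x − 2`, `d = −140`, `h = 1`) -/

-- `IsElliptic` for `35a1 ⊗ ℚ` is the tree's `SSUnitAnchor.isElliptic_ua35a1` (reused, not restated).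

/-- **(A)₂ for `35a1` modulo Lim 2017 Thm. 3.5 (`hLim2`) + ONE displayed bit `2 ∤ #Cl(𝓞 ℚ(β))`** (census value: `h(L_W) = 1`, `d(L_W) = −140` — PARI, not kernel). Row data (Cremona `allcurves`/`allbsd`): minimal model `[0,1,1,9,1]`, `N = 35`, `a₂(E) = 0` (good supersingular at `2`), `r = 0`, `#tors = 3`, non-CM; `2`-division cubic of `β = 4x(P)`: `X³ + 4X² + 144X + 80`; Eisenstein cubic of `π = 2x(P)`: `Y³ + 2Y² + 36Y + 10`; `L_W = ℚ(β) ≅ ℚ[x]/(x³ + 2x − 2)`, complex cubic (Δ_E < 0), `d(L_W) = −140`, `h(L_W) = 1` (kit j343820: polredabs/bnfinit, `bnfcertify = 1`). [cite: Lim2017FineSelmer, §3 Thm. 3.5 and Lemma 3.2] [cite: CoatesSujatha2005, §3 statement (A)] -/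
theorem conjA_two_35a1_of_oddClassNumber
    (hLim2 : Lim2017.thm35_at_two_fineSelmerDual_moduleFinite_of_classicalMuVanishes_of_le_divisionField_four)
    {β : AlgebraicClosure ℚ} (hβ : aeval β (Cubic.toPoly ⟨1, ((4 : ℤ) : ℚ), ((144 : ℤ) : ℚ), ((80 : ℤ) : ℚ)⟩) = 0)
    (hh : ¬ 2 ∣ Nat.card (ClassGroup (𝓞 (IntermediateField.adjoin ℚ {β}))))
    (κ : ZpExtension ℚ 2) (hκ : κ.IsCyclotomic) :
    haveI := SSUnitAnchor.isElliptic_ua35a1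
    ∃ (γ : absoluteGaloisGroup ℚ) (D : ((⟨0, 1, 1, 9, 1⟩ : WeierstrassCurve ℤ).baseChange ℚ).FineSelmerDualData κ γ),
      Module.Finite ℤ_[2] (RestrictScalars ℤ_[2] (IwasawaAlgebra 2) D.X) := by
  haveI := SSUnitAnchor.isElliptic_ua35a1
  exact conjA_two_goodSSModel_of_oddClassNumber hLim2 (1) (9) (1) (by norm_num) (by norm_num) (by norm_num) hβ hh κ hκ

/-- **`FineMuZeroAt (35a1 ⊗ ℚ) 2` modulo `hLim2` + the displayed bit `2 ∤ #Cl(𝓞 ℚ(β))`** (`β` a root of `X³ + 4X² + 144X + 80`; census: `h(L_W) = 1`). [cite: Lim2017FineSelmer, §3 Thm. 3.5 and Lemma 3.2] [cite: CoatesSujatha2005, §3 statement (A)] -/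
theorem fineMuZeroAt_two_35a1_of_oddClassNumber
    (hLim2 : Lim2017.thm35_at_two_fineSelmerDual_moduleFinite_of_classicalMuVanishes_of_le_divisionField_four)
    {β : AlgebraicClosure ℚ} (hβ : aeval β (Cubic.toPoly ⟨1, ((4 : ℤ) : ℚ), ((144 : ℤ) : ℚ), ((80 : ℤ) : ℚ)⟩) = 0)
    (hh : ¬ 2 ∣ Nat.card (ClassGroup (𝓞 (IntermediateField.adjoin ℚ {β})))) :
    haveI := SSUnitAnchor.isElliptic_ua35a1
    Literature.NumberTheory.EllipticCurves.Rank1Residual.FineMuZeroAt ((⟨0, 1, 1, 9, 1⟩ : WeierstrassCurve ℤ).baseChange ℚ) 2 :=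
  haveI := SSUnitAnchor.isElliptic_ua35a1
  fineMuZeroAt_two_goodSSModel_of_oddClassNumber hLim2 (1) (9) (1) (by norm_num) (by norm_num) (by norm_num) hβ hh

/-! ### Row `37b1` = `[0, 1, 1, -23, -50]` (`a₂(E) = 0`; `L_W`: `x³ − x² − 3x + 1`, `d = 148`, `h = 1`) -/

/-- `[0,1,1,-23,-50] ⊗ ℚ` (`37b1`) is an elliptic curve (`256·Δ = disc(X³ + 4X² − 368X − 3184) ≠ 0`). [folklore] -/
theorem isElliptic_37b1 : ((⟨0, 1, 1, -23, -50⟩ : WeierstrassCurve ℤ).baseChange ℚ).IsElliptic :=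
  isElliptic_goodSSModel _ _ _ (by simp only [Cubic.discr]; norm_num)

/-- **(A)₂ for `37b1` modulo Lim 2017 Thm. 3.5 (`hLim2`) + ONE displayed bit `2 ∤ #Cl(𝓞 ℚ(β))`** (census value: `h(L_W) = 1`, `d(L_W) = 148` — PARI, not kernel). Row data (Cremona `allcurves`/`allbsd`): minimal model `[0,1,1,-23,-50]`, `N = 37`, `a₂(E) = 0` (good supersingular at `2`), `r = 0`, `#tors = 3`, non-CM; `2`-division cubic of `β = 4x(P)`: `X³ + 4X² − 368X − 3184`; Eisenstein cubic of `π = 2x(P)`: `Y³ + 2Y² − 92Y − 398`; `L_W = ℚ(β) ≅ ℚ[x]/(x³ − x² − 3x + 1)`, totally real cubic (Δ_E > 0), `d(L_W) = 148`, `h(L_W) = 1` (kit j343820: polredabs/bnfinit, `bnfcertify = 1`). [cite: Lim2017FineSelmer, §3 Thm. 3.5 and Lemma 3.2] [cite: CoatesSujatha2005, §3 statement (A)] -/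
theorem conjA_two_37b1_of_oddClassNumber
    (hLim2 : Lim2017.thm35_at_two_fineSelmerDual_moduleFinite_of_classicalMuVanishes_of_le_divisionField_four)
    {β : AlgebraicClosure ℚ} (hβ : aeval β (Cubic.toPoly ⟨1, ((4 : ℤ) : ℚ), ((-368 : ℤ) : ℚ), ((-3184 : ℤ) : ℚ)⟩) = 0)
    (hh : ¬ 2 ∣ Nat.card (ClassGroup (𝓞 (IntermediateField.adjoin ℚ {β}))))
    (κ : ZpExtension ℚ 2) (hκ : κ.IsCyclotomic) :
    haveI := isElliptic_37b1
    ∃ (γ : absoluteGaloisGroup ℚ) (D : ((⟨0, 1, 1, -23, -50⟩ : WeierstrassCurve ℤ).baseChange ℚ).FineSelmerDualData κ γ),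
      Module.Finite ℤ_[2] (RestrictScalars ℤ_[2] (IwasawaAlgebra 2) D.X) := by
  haveI := isElliptic_37b1
  exact conjA_two_goodSSModel_of_oddClassNumber hLim2 (1) (-23) (-50) (by norm_num) (by norm_num) (by norm_num) hβ hh κ hκ

/-- **`FineMuZeroAt (37b1 ⊗ ℚ) 2` modulo `hLim2` + the displayed bit `2 ∤ #Cl(𝓞 ℚ(β))`** (`β` a root of `X³ + 4X² − 368X − 3184`; census: `h(L_W) = 1`). [cite: Lim2017FineSelmer, §3 Thm. 3.5 and Lemma 3.2] [cite: CoatesSujatha2005, §3 statement (A)] -/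
theorem fineMuZeroAt_two_37b1_of_oddClassNumber
    (hLim2 : Lim2017.thm35_at_two_fineSelmerDual_moduleFinite_of_classicalMuVanishes_of_le_divisionField_four)
    {β : AlgebraicClosure ℚ} (hβ : aeval β (Cubic.toPoly ⟨1, ((4 : ℤ) : ℚ), ((-368 : ℤ) : ℚ), ((-3184 : ℤ) : ℚ)⟩) = 0)
    (hh : ¬ 2 ∣ Nat.card (ClassGroup (𝓞 (IntermediateField.adjoin ℚ {β})))) :
    haveI := isElliptic_37b1
    Literature.NumberTheory.EllipticCurves.Rank1Residual.FineMuZeroAt ((⟨0, 1, 1, -23, -50⟩ : WeierstrassCurve ℤ).baseChange ℚ) 2 :=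
  haveI := isElliptic_37b1
  fineMuZeroAt_two_goodSSModel_of_oddClassNumber hLim2 (1) (-23) (-50) (by norm_num) (by norm_num) (by norm_num) hβ hh

/-! ### Row `51a1` = `[0, 1, 1, 1, -1]` (`a₂(E) = 0`; `L_W`: `x³ − x² + x − 3`, `d = −204`, `h = 1`) -/

-- `IsElliptic` for `51a1 ⊗ ℚ` is the tree's `SSUnitAnchor.isElliptic_ua51a1` (reused, not restated).

/-- **(A)₂ for `51a1` modulo Lim 2017 Thm. 3.5 (`hLim2`) + ONE displayed bit `2 ∤ #Cl(𝓞 ℚ(β))`** (census value: `h(L_W) = 1`, `d(L_W) = −204` — PARI, not kernel). Row data (Cremona `allcurves`/`allbsd`): minimal model `[0,1,1,1,-1]`, `N = 51`, `a₂(E) = 0` (good supersingular at `2`), `r = 0`, `#tors = 3`, non-CM; `2`-division cubic of `β = 4x(P)`: `X³ + 4X² + 16X − 48`; Eisenstein cubic of `π = 2x(P)`: `Y³ + 2Y² + 4Y − 6`; `L_W = ℚ(β) ≅ ℚ[x]/(x³ − x² + x − 3)`, complex cubic (Δ_E < 0), `d(L_W) = −204`, `h(L_W) = 1` (kit j343820: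 polredabs/bnfinit, `bnfcertify = 1`). [cite: Lim2017FineSelmer, §3 Thm. 3.5 and Lemma 3.2] [cite: CoatesSujatha2005, §3 statement (A)] -/
theorem conjA_two_51a1_of_oddClassNumber
    (hLim2 : Lim2017.thm35_at_two_fineSelmerDual_moduleFinite_of_classicalMuVanishes_of_le_divisionField_four)
    {β : AlgebraicClosure ℚ} (hβ : aeval β (Cubic.toPoly ⟨1, ((4 : ℤ) : ℚ), ((16 : ℤ) : ℚ), ((-48 : ℤ) : ℚ)⟩) = 0)
    (hh : ¬ 2 ∣ Nat.card (ClassGroup (𝓞 (IntermediateField.adjoin ℚ {β}))))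
    (κ : ZpExtension ℚ 2) (hκ : κ.IsCyclotomic) :
    haveI := SSUnitAnchor.isElliptic_ua51a1
    ∃ (γ : absoluteGaloisGroup ℚ) (D : ((⟨0, 1, 1, 1, -1⟩ : WeierstrassCurve ℤ).baseChange ℚ).FineSelmerDualData κ γ),
      Module.Finite ℤ_[2] (RestrictScalars ℤ_[2] (IwasawaAlgebra 2) D.X) := by
  haveI := SSUnitAnchor.isElliptic_ua51a1
  exact conjA_two_goodSSModel_of_oddClassNumber hLim2 (1) (1) (-1) (by norm_num) (by norm_num) (by norm_num) hβ hh κ hκ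

/-- **`FineMuZeroAt (51a1 ⊗ ℚ) 2` modulo `hLim2` + the displayed bit `2 ∤ #Cl(𝓞 ℚ(β))`** (`β` a root of `X³ + 4X² + 16X − 48`; census: `h(L_W) = 1`). [cite: Lim2017FineSelmer, §3 Thm. 3.5 and Lemma 3.2] [cite: CoatesSujatha2005, §3 statement (A)] -/
theorem fineMuZeroAt_two_51a1_of_oddClassNumber
    (hLim2 : Lim2017.thm35_at_two_fineSelmerDual_moduleFinite_of_classicalMuVanishes_of_le_divisionField_four)
    {β : AlgebraicClosure ℚ} (hβ : aeval β (Cubic.toPoly ⟨1, ((4 : ℤ) : ℚ), ((16 : ℤ) : ℚ), ((-48 : ℤ) : ℚ)⟩) = 0)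
    (hh : ¬ 2 ∣ Nat.card (ClassGroup (𝓞 (IntermediateField.adjoin ℚ {β})))) :
    haveI := SSUnitAnchor.isElliptic_ua51a1
    Literature.NumberTheory.EllipticCurves.Rank1Residual.FineMuZeroAt ((⟨0, 1, 1, 1, -1⟩ : WeierstrassCurve ℤ).baseChange ℚ) 2 :=
  haveI := SSUnitAnchor.isElliptic_ua51a1
  fineMuZeroAt_two_goodSSModel_of_oddClassNumber hLim2 (1) (1) (-1) (by norm_num) (by norm_num) (by norm_num) hβ hh

/-! ### Row `57c1` = `[0, 1, 1, 20, -32]` (`a₂(E) = −2`; `L_W`: `x³ − 2x − 2`, `d = −76`, `h = 1`) -/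

/-- `[0,1,1,20,-32] ⊗ ℚ` (`57c1`) is an elliptic curve (`256·Δ = disc(X³ + 4X² + 320X − 2032) ≠ 0`). [folklore] -/
theorem isElliptic_57c1 : ((⟨0, 1, 1, 20, -32⟩ : WeierstrassCurve ℤ).baseChange ℚ).IsElliptic :=
  isElliptic_goodSSModel _ _ _ (by simp only [Cubic.discr]; norm_num)

/-- **(A)₂ for `57c1` modulo Lim 2017 Thm. 3.5 (`hLim2`) ALONE — NO displayed datum.** Generator swap: `θ = (286/243) + (13/162)·β + (5/972)·β²` is a root of `g = X³ − 2X − 2` (`d = −76`) and `β = (12) + (14)·θ + (-10)·θ²`, so `ℚ(P) = ℚ(β) = ℚ(θ)`; `2 ∤ #Cl(𝓞 ℚ(θ))` BY THE KERNEL (Eisenstein, r = −2, |disc g| = 76 ≤ 108, `…MinkowskiDoor.card_classGroup_adjoin_eq_one_of_eisenstein_two_of_abs_discr_le`). Row data (Cremona `allcurves`/`allbsd`): minimal model `[0,1,1,20,-32]`, `N = 57`, `a₂(E) = −2` (good supersingular at `2`), `r = 0`, `#tors = 5`, non-CM; `2`-division cubic of `β = 4x(P)`: `X³ + 4X² + 320X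 − 2032`; Eisenstein cubic of `π = 2x(P)`: `Y³ + 2Y² + 80Y − 254`; `L_W = ℚ(β) ≅ ℚ[x]/(x³ − 2x − 2)`, complex cubic (Δ_E < 0), `d(L_W) = −76`, `h(L_W) = 1` (kit j343820: polredabs/bnfinit, `bnfcertify = 1`). [cite: Lim2017FineSelmer, §3 Thm. 3.5 and Lemma 3.2] [cite: CoatesSujatha2005, §3 statement (A)] -/
theorem conjA_two_57c1
    (hLim2 : Lim2017.thm35_at_two_fineSelmerDual_moduleFinite_of_classicalMuVanishes_of_le_divisionField_four)
    (κ : ZpExtension ℚ 2) (hκ : κ.IsCyclotomic) :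
    haveI := isElliptic_57c1
    ∃ (γ : absoluteGaloisGroup ℚ) (D : ((⟨0, 1, 1, 20, -32⟩ : WeierstrassCurve ℤ).baseChange ℚ).FineSelmerDualData κ γ),
      Module.Finite ℤ_[2] (RestrictScalars ℤ_[2] (IwasawaAlgebra 2) D.X) := by
  haveI := isElliptic_57c1
  refine conjA_two_goodSSModel_of_generator hLim2 (1) (20) (-32) (0) (-2) (-2) (286/243) (13/162) (5/972) (12) (14) (-10)
    (fun β θ hβ hθ ↦ ?_) (fun θ hθ ↦ not_two_dvd_card_classGroup_twoDivField_d76n hθ) κ hκ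
  subst hθ; push_cast at hβ ⊢
  exact ⟨by linear_combination (((153859 : AlgebraicClosure ℚ) / 114791256) + ((28915 : AlgebraicClosure ℚ) / 229582512) * β + ((2675 : AlgebraicClosure ℚ) / 459165024) * β ^ 2 + ((125 : AlgebraicClosure ℚ) / 918330048) * β ^ 3) * hβ,
    by linear_combination (-1 : AlgebraicClosure ℚ) * (((-425 : AlgebraicClosure ℚ) / 59049) + ((-125 : AlgebraicClosure ℚ) / 472392) * β) * hβ⟩

/-- **`FineMuZeroAt (57c1 ⊗ ℚ) 2` modulo `hLim2` ALONE** (kernel bit via the `d = −76` generator swap). [cite: Lim2017FineSelmer, §3 Thm. 3.5 and Lemma 3.2] [cite: CoatesSujatha2005, §3 statement (A)] -/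
theorem fineMuZeroAt_two_57c1
    (hLim2 : Lim2017.thm35_at_two_fineSelmerDual_moduleFinite_of_classicalMuVanishes_of_le_divisionField_four) :
    haveI := isElliptic_57c1
    Literature.NumberTheory.EllipticCurves.Rank1Residual.FineMuZeroAt ((⟨0, 1, 1, 20, -32⟩ : WeierstrassCurve ℤ).baseChange ℚ) 2 :=
  haveI := isElliptic_57c1
  Literature.NumberTheory.EllipticCurves.Rank1Residual.ConjAAt.fineMuZeroAt (conjA_two_57c1 hLim2)

/-! ### Row `67a1` = `[0, 1, 1, -12, -21]` (`a₂(E) = 2`; `L_W`: `x³ − x² − 3x + 5`, `d = −268`, `h = 1`) -/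

-- `IsElliptic` for `67a1 ⊗ ℚ` is the tree's `SSUnitAnchor.isElliptic_ua67a1` (reused, not restated).

/-- **(A)₂ for `67a1` modulo Lim 2017 Thm. 3.5 (`hLim2`) + ONE displayed bit `2 ∤ #Cl(𝓞 ℚ(β))`** (census value: `h(L_W) = 1`, `d(L_W) = −268` — PARI, not kernel). Row data (Cremona `allcurves`/`allbsd`): minimal model `[0,1,1,-12,-21]`, `N = 67`, `a₂(E) = 2` (good supersingular at `2`), `r = 0`, `#tors = 1`, non-CM; `2`-division cubic of `β = 4x(P)`: `X³ + 4X² − 192X − 1328`; Eisenstein cubic of `π = 2x(P)`: `Y³ + 2Y² − 48Y − 166`; `L_W = ℚ(β) ≅ ℚ[x]/(x³ − x² − 3x + 5)`, complex cubic (Δ_E < 0), `d(L_W) = −268`, `h(L_W) = 1` (kit j343820: polredabs/bnfinit, `bnfcertify = 1`). [cite: Lim2017FineSelmer, §3 Thm. 3.5 and Lemma 3.2] [cite: CoatesSujatha2005, §3 statement (A)] -/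
theorem conjA_two_67a1_of_oddClassNumber
    (hLim2 : Lim2017.thm35_at_two_fineSelmerDual_moduleFinite_of_classicalMuVanishes_of_le_divisionField_four)
    {β : AlgebraicClosure ℚ} (hβ : aeval β (Cubic.toPoly ⟨1, ((4 : ℤ) : ℚ), ((-192 : ℤ) : ℚ), ((-1328 : ℤ) : ℚ)⟩) = 0)
    (hh : ¬ 2 ∣ Nat.card (ClassGroup (𝓞 (IntermediateField.adjoin ℚ {β}))))
    (κ : ZpExtension ℚ 2) (hκ : κ.IsCyclotomic) :
    haveI := SSUnitAnchor.isElliptic_ua67a1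
    ∃ (γ : absoluteGaloisGroup ℚ) (D : ((⟨0, 1, 1, -12, -21⟩ : WeierstrassCurve ℤ).baseChange ℚ).FineSelmerDualData κ γ),
      Module.Finite ℤ_[2] (RestrictScalars ℤ_[2] (IwasawaAlgebra 2) D.X) := by
  haveI := SSUnitAnchor.isElliptic_ua67a1
  exact conjA_two_goodSSModel_of_oddClassNumber hLim2 (1) (-12) (-21) (by norm_num) (by norm_num) (by norm_num) hβ hh κ hκ

/-- **`FineMuZeroAt (67a1 ⊗ ℚ) 2` modulo `hLim2` + the displayed bit `2 ∤ #Cl(𝓞 ℚ(β))`** (`β` a root of `X³ + 4X² − 192X − 1328`; census: `h(L_W) = 1`). [cite: Lim2017FineSelmer, §3 Thm. 3.5 and Lemma 3.2] [cite: CoatesSujatha2005, §3 statement (A)] -/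
theorem fineMuZeroAt_two_67a1_of_oddClassNumber
    (hLim2 : Lim2017.thm35_at_two_fineSelmerDual_moduleFinite_of_classicalMuVanishes_of_le_divisionField_four)
    {β : AlgebraicClosure ℚ} (hβ : aeval β (Cubic.toPoly ⟨1, ((4 : ℤ) : ℚ), ((-192 : ℤ) : ℚ), ((-1328 : ℤ) : ℚ)⟩) = 0)
    (hh : ¬ 2 ∣ Nat.card (ClassGroup (𝓞 (IntermediateField.adjoin ℚ {β})))) :
    haveI := SSUnitAnchor.isElliptic_ua67a1
    Literature.NumberTheory.EllipticCurves.Rank1Residual.FineMuZeroAt ((⟨0, 1, 1, -12, -21⟩ : WeierstrassCurve ℤ).baseChange ℚ) 2 :=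
  haveI := SSUnitAnchor.isElliptic_ua67a1
  fineMuZeroAt_two_goodSSModel_of_oddClassNumber hLim2 (1) (-12) (-21) (by norm_num) (by norm_num) (by norm_num) hβ hh

/-! ### Row `75a1` = `[0, -1, 1, -8, -7]` (`a₂(E) = 2`; `L_W`: `x³ − x² − 3x − 3`, `d = −300`, `h = 1`) -/

-- `IsElliptic` for `75a1 ⊗ ℚ` is the tree's `SSUnitAnchor.isElliptic_ua75a1` (reused, not restated).

/-- **(A)₂ for `75a1` modulo Lim 2017 Thm. 3.5 (`hLim2`) + ONE displayed bit `2 ∤ #Cl(𝓞 ℚ(β))`** (census value: `h(L_W) = 1`, `d(L_W) = −300` — PARI, not kernel). Row data (Cremona `allcurves`/`allbsd`): minimal model `[0,-1,1,-8,-7]`, `N = 75`, `a₂(E) = 2` (good supersingular at `2`), `r = 0`, `#tors = 1`, non-CM; `2`-division cubic of `β = 4x(P)`: `X³ − 4X² − 128X − 432`; Eisenstein cubic of `π = 2x(P)`: `Y³ − 2Y² − 32Y − 54`; `L_W = ℚ(β) ≅ ℚ[x]/(x³ − x² − 3x − 3)`, complex cubic (Δ_E < 0), `d(L_W) = −300`,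 `h(L_W) = 1` (kit j343820: polredabs/bnfinit, `bnfcertify = 1`). [cite: Lim2017FineSelmer, §3 Thm. 3.5 and Lemma 3.2] [cite: CoatesSujatha2005, §3 statement (A)] -/
theorem conjA_two_75a1_of_oddClassNumber
    (hLim2 : Lim2017.thm35_at_two_fineSelmerDual_moduleFinite_of_classicalMuVanishes_of_le_divisionField_four)
    {β : AlgebraicClosure ℚ} (hβ : aeval β (Cubic.toPoly ⟨1, ((-4 : ℤ) : ℚ), ((-128 : ℤ) : ℚ), ((-432 : ℤ) : ℚ)⟩) = 0)
    (hh : ¬ 2 ∣ Nat.card (ClassGroup (𝓞 (IntermediateField.adjoin ℚ {β}))))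
    (κ : ZpExtension ℚ 2) (hκ : κ.IsCyclotomic) :
    haveI := SSUnitAnchor.isElliptic_ua75a1
    ∃ (γ : absoluteGaloisGroup ℚ) (D : ((⟨0, -1, 1, -8, -7⟩ : WeierstrassCurve ℤ).baseChange ℚ).FineSelmerDualData κ γ),
      Module.Finite ℤ_[2] (RestrictScalars ℤ_[2] (IwasawaAlgebra 2) D.X) := by
  haveI := SSUnitAnchor.isElliptic_ua75a1
  exact conjA_two_goodSSModel_of_oddClassNumber hLim2 (-1) (-8) (-7) (by norm_num) (by norm_num) (by norm_num) hβ hh κ hκ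

/-- **`FineMuZeroAt (75a1 ⊗ ℚ) 2` modulo `hLim2` + the displayed bit `2 ∤ #Cl(𝓞 ℚ(β))`** (`β` a root of `X³ − 4X² − 128X − 432`; census: `h(L_W) = 1`). [cite: Lim2017FineSelmer, §3 Thm. 3.5 and Lemma 3.2] [cite: CoatesSujatha2005, §3 statement (A)] -/
theorem fineMuZeroAt_two_75a1_of_oddClassNumber
    (hLim2 : Lim2017.thm35_at_two_fineSelmerDual_moduleFinite_of_classicalMuVanishes_of_le_divisionField_four)
    {β : AlgebraicClosure ℚ} (hβ : aeval β (Cubic.toPoly ⟨1, ((-4 : ℤ) : ℚ), ((-128 : ℤ) : ℚ), ((-432 : ℤ) : ℚ)⟩) = 0)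
    (hh : ¬ 2 ∣ Nat.card (ClassGroup (𝓞 (IntermediateField.adjoin ℚ {β})))) :
    haveI := SSUnitAnchor.isElliptic_ua75a1
    Literature.NumberTheory.EllipticCurves.Rank1Residual.FineMuZeroAt ((⟨0, -1, 1, -8, -7⟩ : WeierstrassCurve ℤ).baseChange ℚ) 2 :=
  haveI := SSUnitAnchor.isElliptic_ua75a1
  fineMuZeroAt_two_goodSSModel_of_oddClassNumber hLim2 (-1) (-8) (-7) (by norm_num) (by norm_num) (by norm_num) hβ hh

/-! ### Row `75c1` = `[0, 1, 1, 2, 4]` (`a₂(E) = −2`; `L_W`: `x³ − x² − 3x − 3`, `d = −300`, `h = 1`) -/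

/-- `[0,1,1,2,4] ⊗ ℚ` (`75c1`) is an elliptic curve (`256·Δ = disc(X³ + 4X² + 32X + 272) ≠ 0`). [folklore] -/
theorem isElliptic_75c1 : ((⟨0, 1, 1, 2, 4⟩ : WeierstrassCurve ℤ).baseChange ℚ).IsElliptic :=
  isElliptic_goodSSModel _ _ _ (by simp only [Cubic.discr]; norm_num)

/-- **(A)₂ for `75c1` modulo Lim 2017 Thm. 3.5 (`hLim2`) + ONE displayed bit `2 ∤ #Cl(𝓞 ℚ(β))`** (census value: `h(L_W) = 1`, `d(L_W) = −300` — PARI, not kernel). Row data (Cremona `allcurves`/`allbsd`): minimal model `[0,1,1,2,4]`, `N = 75`, `a₂(E) = −2` (good supersingular at `2`), `r = 0`, `#tors = 5`, non-CM; `2`-division cubic of `β = 4x(P)`: `X³ + 4X² + 32X + 272`; Eisenstein cubic of `π = 2x(P)`: `Y³ + 2Y² + 8Y + 34`; `L_W = ℚ(β) ≅ ℚ[x]/(x³ − x² − 3x − 3)`, complex cubic (Δ_E < 0), `d(L_W) = −300`, `h(L_W) = 1` (kit j343820: polredabs/bnfinit, `bnfcertify = 1`). [cite: Lim2017FineSelmer,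 §3 Thm. 3.5 and Lemma 3.2] [cite: CoatesSujatha2005, §3 statement (A)] -/
theorem conjA_two_75c1_of_oddClassNumber
    (hLim2 : Lim2017.thm35_at_two_fineSelmerDual_moduleFinite_of_classicalMuVanishes_of_le_divisionField_four)
    {β : AlgebraicClosure ℚ} (hβ : aeval β (Cubic.toPoly ⟨1, ((4 : ℤ) : ℚ), ((32 : ℤ) : ℚ), ((272 : ℤ) : ℚ)⟩) = 0)
    (hh : ¬ 2 ∣ Nat.card (ClassGroup (𝓞 (IntermediateField.adjoin ℚ {β}))))
    (κ : ZpExtension ℚ 2) (hκ : κ.IsCyclotomic) :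
    haveI := isElliptic_75c1
    ∃ (γ : absoluteGaloisGroup ℚ) (D : ((⟨0, 1, 1, 2, 4⟩ : WeierstrassCurve ℤ).baseChange ℚ).FineSelmerDualData κ γ),
      Module.Finite ℤ_[2] (RestrictScalars ℤ_[2] (IwasawaAlgebra 2) D.X) := by
  haveI := isElliptic_75c1
  exact conjA_two_goodSSModel_of_oddClassNumber hLim2 (1) (2) (4) (by norm_num) (by norm_num) (by norm_num) hβ hh κ hκ

/-- **`FineMuZeroAt (75c1 ⊗ ℚ) 2` modulo `hLim2` + the displayed bit `2 ∤ #Cl(𝓞 ℚ(β))`** (`β` a root of `X³ + 4X² + 32X + 272`; census: `h(L_W) = 1`). [cite: Lim2017FineSelmer, §3 Thm. 3.5 and Lemma 3.2] [cite: CoatesSujatha2005, §3 statement (A)] -/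
theorem fineMuZeroAt_two_75c1_of_oddClassNumber
    (hLim2 : Lim2017.thm35_at_two_fineSelmerDual_moduleFinite_of_classicalMuVanishes_of_le_divisionField_four)
    {β : AlgebraicClosure ℚ} (hβ : aeval β (Cubic.toPoly ⟨1, ((4 : ℤ) : ℚ), ((32 : ℤ) : ℚ), ((272 : ℤ) : ℚ)⟩) = 0)
    (hh : ¬ 2 ∣ Nat.card (ClassGroup (𝓞 (IntermediateField.adjoin ℚ {β})))) :
    haveI := isElliptic_75c1
    Literature.NumberTheory.EllipticCurves.Rank1Residual.FineMuZeroAt ((⟨0, 1, 1, 2, 4⟩ : WeierstrassCurve ℤ).baseChange ℚ) 2 :=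
  haveI := isElliptic_75c1
  fineMuZeroAt_two_goodSSModel_of_oddClassNumber hLim2 (1) (2) (4) (by norm_num) (by norm_num) (by norm_num) hβ hh

/-! ### Row `77b1` = `[0, 1, 1, -49, 600]` (`a₂(E) = 0`; `L_W`: `x³ − x² + x + 1`, `d = −44`, `h = 1`) -/

/-- `[0,1,1,-49,600] ⊗ ℚ` (`77b1`) is an elliptic curve (`256·Δ = disc(X³ + 4X² − 784X + 38416) ≠ 0`). [folklore] -/
theorem isElliptic_77b1 : ((⟨0, 1, 1, -49, 600⟩ : WeierstrassCurve ℤ).baseChange ℚ).IsElliptic :=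
  isElliptic_goodSSModel _ _ _ (by simp only [Cubic.discr]; norm_num)

/-- **(A)₂ for `77b1` modulo Lim 2017 Thm. 3.5 (`hLim2`) ALONE — NO displayed datum.** Generator swap: `θ = (65/77) + (-79/7546)·β + (-15/15092)·β²` is a root of `g = X³ − X² + X + 1` (`d = −44`) and `β = (-20) + (26)·θ + (-30)·θ²`, so `ℚ(P) = ℚ(β) = ℚ(θ)`; `2 ∤ #Cl(𝓞 ℚ(θ))` BY THE KERNEL (|disc g| = 44 ≤ 45, `…CubicDiscriminant.not_two_dvd_card_classGroup_adjoin_of_abs_discr_le`). Row data (Cremona `allcurves`/`allbsd`): minimal model `[0,1,1,-49,600]`, `N = 77`, `a₂(E) = 0` (good supersingular at `2`), `r = 0`, `#tors = 3`, non-CM; `2`-division cubic of `β = 4x(P)`: `X³ + 4X² − 784X + 38416`; Eisenstein cubic of `π = 2x(P)`: `Y³ + 2Y² − 196Y + 4802`; `L_W = ℚ(β) ≅ ℚ[x]/(x³ − x² + x + 1)`, complex cubic (Δ_E < 0), `d(L_W) = −44`, `h(L_W) = 1` (kit j343820: polredabs/bnfinit, `bnfcertify = 1`). [cite: Lim2017FineSelmer,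 §3 Thm. 3.5 and Lemma 3.2] [cite: CoatesSujatha2005, §3 statement (A)] -/
theorem conjA_two_77b1
    (hLim2 : Lim2017.thm35_at_two_fineSelmerDual_moduleFinite_of_classicalMuVanishes_of_le_divisionField_four)
    (κ : ZpExtension ℚ 2) (hκ : κ.IsCyclotomic) :
    haveI := isElliptic_77b1
    ∃ (γ : absoluteGaloisGroup ℚ) (D : ((⟨0, 1, 1, -49, 600⟩ : WeierstrassCurve ℤ).baseChange ℚ).FineSelmerDualData κ γ),
      Module.Finite ℤ_[2] (RestrictScalars ℤ_[2] (IwasawaAlgebra 2) D.X) := by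
  haveI := isElliptic_77b1
  refine conjA_two_goodSSModel_of_generator hLim2 (1) (-49) (600) (-1) (1) (1) (65/77) (-79/7546) (-15/15092) (-20) (26) (-30)
    (fun β θ hβ hθ ↦ ?_) (fun θ hθ ↦ not_two_dvd_card_classGroup_twoDivField_d44n hθ) κ hκ
  subst hθ; push_cast at hβ ⊢
  exact ⟨by linear_combination (((395609 : AlgebraicClosure ℚ) / 8769085864) + ((451755 : AlgebraicClosure ℚ) / 859370414672) * β + ((-46575 : AlgebraicClosure ℚ) / 1718740829344) * β ^ 2 + ((-3375 : AlgebraicClosure ℚ) / 3437481658688) * β ^ 3) * hβ,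
    by linear_combination (-1 : AlgebraicClosure ℚ) * (((-7200 : AlgebraicClosure ℚ) / 14235529) + ((-3375 : AlgebraicClosure ℚ) / 113884232) * β) * hβ⟩

/-- **`FineMuZeroAt (77b1 ⊗ ℚ) 2` modulo `hLim2` ALONE** (kernel bit via the `d = −44` generator swap). [cite: Lim2017FineSelmer, §3 Thm. 3.5 and Lemma 3.2] [cite: CoatesSujatha2005, §3 statement (A)] -/
theorem fineMuZeroAt_two_77b1
    (hLim2 : Lim2017.thm35_at_two_fineSelmerDual_moduleFinite_of_classicalMuVanishes_of_le_divisionField_four) :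
    haveI := isElliptic_77b1
    Literature.NumberTheory.EllipticCurves.Rank1Residual.FineMuZeroAt ((⟨0, 1, 1, -49, 600⟩ : WeierstrassCurve ℤ).baseChange ℚ) 2 :=
  haveI := isElliptic_77b1
  Literature.NumberTheory.EllipticCurves.Rank1Residual.ConjAAt.fineMuZeroAt (conjA_two_77b1 hLim2)

end Summit.BirchSwinnertonDyer.BirchSwinnertonDyer.Theorems.AddKatoTwo

end
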